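import Literature.AlgebraicTopology.Homotopy.CubePairMaps
import Literature.AlgebraicTopology.Homotopy.SequenceTelescope
import HarnessLib

/-!
# The half-turn of a cube in a coordinate plane is homotopic to the identity through maps of pairs

Topic `Literature/AlgebraicTopology/Homotopy`. For two coordinates `a ≠ b` of the cube
`Iᴺ = Fin N → I`, the **half-turn** `y ↦ (…, 1 - y_a, …, 1 - y_b, …)` (the rotation by `π` of the
`(y_a, y_b)`-square about its centre, all other coordinates fixed) is homotopic to the identity
**through maps of pairs `(Iᴺ, ∂Iᴺ) → (Iᴺ, ∂Iᴺ)`** (`HalfTurn.exists_homotopy`). This is the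
elementary fact that two reflections of the cube in coordinate hyperplanes are homotopic as maps of
pairs (their composite is a rotation), used in `Literature/AlgebraicTopology/SingularHomology/` to
compare cube–simplex devices of opposite orientation conventions (the radial device of
`RelativeSimplexClass.lean` and the cone chart of `JoinCube.lean`).

The homotopy is written without trigonometry, on the square `I²` in coordinates centred at
`(½, ½)` and clamped back into the square (`HalfTurn.pt`, through the tree's clamp `clampI` of
`CollaredDeformationRetract.lean`): scale by `1 + t` (`HalfTurn.scale`),
then shear `M_t = (1 - t)·id + t·J` towards the quarter-turn `J(u, v) = (-v, u)`, doubled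
(`HalfTurn.shear`; on `∂I²` the doubled shear has sup norm `≥ ½` since
`‖M_t p‖² ≥ (a² + b²)‖p‖₂² / 2`, so the clamp lands on `∂I²`), then the same shear turned by `J`,
then scale back; the four stages are glued by `ContinuousMap.HomotopyWith.trans` and lifted to the
cube by the pair moves `CubeHAT.pairMap` of `CubePairMaps.lean`. Everything is proved;
`[folklore]` (Hatcher, *Algebraic Topology* (2002), §4.1, p. 340: maps of pairs `(Iⁿ, ∂Iⁿ)`).

## References

* A. Hatcher, *Algebraic Topology*, CUP (2002), §4.1, p. 340. [HatcherAT2002]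
-/

noncomputable section

open scoped unitInterval Topology
open Set Function unitInterval

namespace Literature.AlgebraicTopology.Homotopy

namespace HalfTurn

open CubeHAT (pairMap pairMap_apply_fst pairMap_apply_snd pairMap_apply_of_ne continuous_pairMap
  continuous_pairMap₂ pairMap_mem_boundary)
open SquareUnfold (sqBoundary mem_sqBoundary_iff)

/-! ### Clamped centred coordinates on the square -/

attribute [local fun_prop] continuous_clampI

/-- `clampI (1 - x) = 1 - clampI x` (the tree's `SeqTelescope.symm_clampI`, reversed). [folklore] -/
lemma clampI_one_sub (x : ℝ) : clampI (1 - x) = σ (clampI x) := (SeqTelescope.symm_clampI x).symm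

/-- First coordinate centred at `½`. [folklore] -/
def cu (p : I × I) : ℝ := (p.1 : ℝ) - 1 / 2

/-- Second coordinate centred at `½`. [folklore] -/
def cv (p : I × I) : ℝ := (p.2 : ℝ) - 1 / 2

/-- `cu` is continuous. [folklore] -/
@[fun_prop] lemma continuous_cu : Continuous cu := by unfold cu; fun_prop

/-- `cv` is continuous. [folklore] -/
@[fun_prop] lemma continuous_cv : Continuous cv := by unfold cv; fun_prop

/-- `|cu p| ≤ ½`. [folklore] -/
lemma abs_cu_le (p : I × I) : |cu p| ≤ 1 / 2 := by
  rw [cu, abs_le]; constructor <;> linarith [p.1.2.1, p.1.2.2]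

/-- `|cv p| ≤ ½`. [folklore] -/
lemma abs_cv_le (p : I × I) : |cv p| ≤ 1 / 2 := by
  rw [cv, abs_le]; constructor <;> linarith [p.2.2.1, p.2.2.2]

/-- The point of the square with centred coordinates `(x, y)`, clamped into the square. [folklore] -/
def pt (x y : ℝ) : I × I := (clampI (x + 1 / 2), clampI (y + 1 / 2))

/-- `pt` is continuous. [folklore] -/
@[fun_prop] lemma continuous_pt : Continuous fun q : ℝ × ℝ => pt q.1 q.2 := by
  unfold pt; fun_prop

/-- `pt (cu p) (cv p) = p`. [folklore] -/
@[simp] lemma pt_cu_cv (p : I × I) : pt (cu p) (cv p) = p := by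
  rcases p with ⟨s, u⟩
  simp only [pt, cu, cv, sub_add_cancel, clampI_coe]

/-- On the boundary of the square one centred coordinate has absolute value `½`. [folklore] -/
lemma sq_le_of_mem_sqBoundary {p : I × I} (hp : p ∈ sqBoundary) : 1 / 4 ≤ cu p ^ 2 + cv p ^ 2 := by
  rw [mem_sqBoundary_iff] at hp
  rcases hp with h | h | h | h
  · have : cu p = -(1 / 2) := by rw [cu, h, Icc.coe_zero]; ring
    nlinarith [sq_nonneg (cv p)]
  · have : cu p = 1 / 2 := by rw [cu, h, Icc.coe_one]; ring
    nlinarith [sq_nonneg (cv p)]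
  · have : cv p = -(1 / 2) := by rw [cv, h, Icc.coe_zero]; ring
    nlinarith [sq_nonneg (cu p)]
  · have : cv p = 1 / 2 := by rw [cv, h, Icc.coe_one]; ring
    nlinarith [sq_nonneg (cu p)]

/-- A clamped point with a centred coordinate of absolute value `≥ ½` lies on `∂I²`. [folklore] -/
lemma pt_mem_sqBoundary {x y : ℝ} (h : 1 / 2 ≤ |x| ∨ 1 / 2 ≤ |y|) : pt x y ∈ sqBoundary := by
  rw [mem_sqBoundary_iff]
  rcases h with h | h
  · rcases le_abs'.1 h with h | h
    · exact Or.inl (clampI_of_nonpos (by linarith))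
    · exact Or.inr (Or.inl (clampI_of_one_le (by linarith)))
  · rcases le_abs'.1 h with h | h
    · exact Or.inr (Or.inr (Or.inl (clampI_of_nonpos (by linarith))))
    · exact Or.inr (Or.inr (Or.inr (clampI_of_one_le (by linarith))))

/-! ### The four planar stages -/

/-- **Stage 1**: scale the square about its centre by `1 + t` and clamp. [folklore] -/
def scale (t : I) (p : I × I) : I × I := pt ((1 + t) * cu p) ((1 + t) * cv p)

/-- **Stage 2**: the doubled shear `2 M_t`, `M_t = (1 - t)·id + t·J` with `J (u, v) = (-v, u)`,
clamped. [folklore] -/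
def shear (t : I) (p : I × I) : I × I :=
  pt (2 * ((1 - t) * cu p - t * cv p)) (2 * (t * cu p + (1 - t) * cv p))

/-- The quarter-turn `J` of the square about its centre. [folklore] -/
def qt (p : I × I) : I × I := (σ p.2, p.1)

/-- **The half-turn** of the square about its centre. [folklore] -/
def ht (p : I × I) : I × I := (σ p.1, σ p.2)

/-- `scale` is jointly continuous. [folklore] -/
lemma continuous_scale : Continuous fun q : I × (I × I) => scale q.1 q.2 := by
  have h1 : Continuous fun q : I × (I × I) => (1 + (q.1 : ℝ)) * cu q.2 := by fun_prop
  have h2 : Continuous fun q : I × (I × I) => (1 + (q.1 : ℝ)) * cv q.2 := by fun_prop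
  exact continuous_pt.comp (h1.prodMk h2)

/-- `shear` is jointly continuous. [folklore] -/
lemma continuous_shear : Continuous fun q : I × (I × I) => shear q.1 q.2 := by
  have h1 : Continuous fun q : I × (I × I) => 2 * ((1 - (q.1 : ℝ)) * cu q.2 - (q.1 : ℝ) * cv q.2) := by
    fun_prop
  have h2 : Continuous fun q : I × (I × I) => 2 * ((q.1 : ℝ) * cu q.2 + (1 - (q.1 : ℝ)) * cv q.2) := by
    fun_prop
  exact continuous_pt.comp (h1.prodMk h2)

/-- `scale t` is continuous (stated in curried form, so that no unfolding of the real-arithmetic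
bodies is needed downstream). [folklore] -/
lemma continuous_scale_right (t : I) : Continuous (scale t) := by
  have h1 : Continuous fun p : I × I => (1 + (t : ℝ)) * cu p := by fun_prop
  have h2 : Continuous fun p : I × I => (1 + (t : ℝ)) * cv p := by fun_prop
  exact continuous_pt.comp (h1.prodMk h2)

/-- `shear t` is continuous (curried form). [folklore] -/
lemma continuous_shear_right (t : I) : Continuous (shear t) := by
  have h1 : Continuous fun p : I × I => 2 * ((1 - (t : ℝ)) * cu p - (t : ℝ) * cv p) := by fun_prop
  have h2 : Continuous fun p : I × I => 2 * ((t : ℝ) * cu p + (1 - (t : ℝ)) * cv p) := by fun_prop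
  exact continuous_pt.comp (h1.prodMk h2)

/-- `qt` is continuous. [folklore] -/
@[fun_prop] lemma continuous_qt : Continuous qt := by unfold qt; fun_prop

/-- `ht` is continuous. [folklore] -/
@[fun_prop] lemma continuous_ht : Continuous ht := by unfold ht; fun_prop

/-- `scale 0 = id`. [folklore] -/
lemma scale_zero (p : I × I) : scale 0 p = p := by
  simp only [scale, Icc.coe_zero, add_zero, one_mul, pt_cu_cv]

/-- `shear 0 = scale 1`. [folklore] -/
lemma shear_zero (p : I × I) : shear 0 p = scale 1 p := by
  refine Prod.ext ?_ ?_
  · change clampI (2 * ((1 - ((0 : I) : ℝ)) * cu p - ((0 : I) : ℝ) * cv p) + 1 / 2) =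
      clampI ((1 + ((1 : I) : ℝ)) * cu p + 1 / 2)
    rw [Icc.coe_zero, Icc.coe_one]; exact congrArg clampI (by ring)
  · change clampI (2 * (((0 : I) : ℝ) * cu p + (1 - ((0 : I) : ℝ)) * cv p) + 1 / 2) =
      clampI ((1 + ((1 : I) : ℝ)) * cv p + 1 / 2)
    rw [Icc.coe_zero, Icc.coe_one]; exact congrArg clampI (by ring)

/-- `shear 1 = qt ∘ scale 1` (the doubled quarter-turn). [folklore] -/
lemma shear_one (p : I × I) : shear 1 p = qt (scale 1 p) := by
  refine Prod.ext ?_ ?_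
  · change clampI (2 * ((1 - ((1 : I) : ℝ)) * cu p - ((1 : I) : ℝ) * cv p) + 1 / 2) =
      σ (clampI ((1 + ((1 : I) : ℝ)) * cv p + 1 / 2))
    rw [Icc.coe_one, ← clampI_one_sub]; exact congrArg clampI (by ring)
  · change clampI (2 * (((1 : I) : ℝ) * cu p + (1 - ((1 : I) : ℝ)) * cv p) + 1 / 2) =
      clampI ((1 + ((1 : I) : ℝ)) * cu p + 1 / 2)
    rw [Icc.coe_one]; exact congrArg clampI (by ring)

/-- `qt ∘ qt = ht`. [folklore] -/
lemma qt_qt (p : I × I) : qt (qt p) = ht p := rfl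

/-- `qt` preserves `∂I²`. [folklore] -/
lemma qt_mem_sqBoundary {p : I × I} (hp : p ∈ sqBoundary) : qt p ∈ sqBoundary := by
  rw [mem_sqBoundary_iff] at hp ⊢
  unfold qt
  rcases hp with h | h | h | h
  · exact Or.inr (Or.inr (Or.inl h))
  · exact Or.inr (Or.inr (Or.inr h))
  · exact Or.inr (Or.inl (by rw [h, symm_zero]))
  · exact Or.inl (by rw [h, symm_one])

/-- `ht` preserves `∂I²`. [folklore] -/
lemma ht_mem_sqBoundary {p : I × I} (hp : p ∈ sqBoundary) : ht p ∈ sqBoundary := by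
  rw [← qt_qt]; exact qt_mem_sqBoundary (qt_mem_sqBoundary hp)

/-- `scale t` preserves `∂I²` (a coordinate of absolute value `½` becomes `(1 + t)/2 ≥ ½`). [folklore] -/
lemma scale_mem_sqBoundary (t : I) {p : I × I} (hp : p ∈ sqBoundary) : scale t p ∈ sqBoundary := by
  refine pt_mem_sqBoundary ?_
  have ht0 : (0 : ℝ) ≤ t := t.2.1
  rw [mem_sqBoundary_iff] at hp
  rcases hp with h | h | h | h
  · left
    have : cu p = -(1 / 2) := by rw [cu, h, Icc.coe_zero]; ring
    rw [this, abs_of_nonpos (by nlinarith)]; nlinarith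
  · left
    have : cu p = 1 / 2 := by rw [cu, h, Icc.coe_one]; ring
    rw [this, abs_of_nonneg (by nlinarith)]; nlinarith
  · right
    have : cv p = -(1 / 2) := by rw [cv, h, Icc.coe_zero]; ring
    rw [this, abs_of_nonpos (by nlinarith)]; nlinarith
  · right
    have : cv p = 1 / 2 := by rw [cv, h, Icc.coe_one]; ring
    rw [this, abs_of_nonneg (by nlinarith)]; nlinarith

/-- **The doubled shear keeps the boundary of the square outside the open square**: if
`a + b = 1` and `x² + y² ≥ ¼` then `|2(ax - by)| ≥ ½` or `|2(bx + ay)| ≥ ½`, because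
`(ax - by)² + (bx + ay)² = (a² + b²)(x² + y²) ≥ ⅛`. [folklore] -/
lemma half_le_abs_or (a b x y : ℝ) (hab : a + b = 1) (hxy : 1 / 4 ≤ x ^ 2 + y ^ 2) :
    1 / 2 ≤ |2 * (a * x - b * y)| ∨ 1 / 2 ≤ |2 * (b * x + a * y)| := by
  by_contra h
  rw [not_or, not_le, not_le] at h
  obtain ⟨h1, h2⟩ := h
  have h1' := (abs_lt.1 h1)
  have h2' := (abs_lt.1 h2)
  have hid : (a * x - b * y) ^ 2 + (b * x + a * y) ^ 2 = (a ^ 2 + b ^ 2) * (x ^ 2 + y ^ 2) := by ring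
  have hab2 : 1 / 2 ≤ a ^ 2 + b ^ 2 := by nlinarith [sq_nonneg (a - b)]
  have hlow : 1 / 8 ≤ (a * x - b * y) ^ 2 + (b * x + a * y) ^ 2 := by
    rw [hid]; nlinarith
  nlinarith [h1'.1, h1'.2, h2'.1, h2'.2]

/-- `shear t` preserves `∂I²`. [folklore] -/
lemma shear_mem_sqBoundary (t : I) {p : I × I} (hp : p ∈ sqBoundary) : shear t p ∈ sqBoundary :=
  pt_mem_sqBoundary (half_le_abs_or (1 - t) t (cu p) (cv p) (by ring) (sq_le_of_mem_sqBoundary hp))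

/-! ### Lifting planar stages to the cube -/

variable {N : ℕ} {a b : Fin N}

/-- The self-map `pairMap a b θ` of the cube as a continuous map. [folklore] -/
def pm (a b : Fin N) (θ : I × I → I × I) (hθ : Continuous θ) : C((Fin N → I), Fin N → I) :=
  ⟨pairMap a b θ, continuous_pairMap hθ⟩

/-- `pm` pointwise. [folklore] -/
@[simp] lemma pm_apply (θ : I × I → I × I) (hθ : Continuous θ) (y : Fin N → I) : pm a b θ hθ y = pairMap a b θ y :=
  rfl

/-- The predicate "maps `∂Iᴺ` into `∂Iᴺ`" on self-maps of the cube. [folklore] -/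
def BdPres (f : C((Fin N → I), Fin N → I)) : Prop := MapsTo f (Cube.boundary (Fin N)) (Cube.boundary (Fin N))

/-- **A planar stage lifts to a homotopy of maps of pairs of the cube** between any two self-maps
of the cube that are pointwise its ends. [folklore] -/
def stage (hab : a ≠ b) (Θ : I → I × I → I × I) (hΘ : Continuous fun q : I × (I × I) => Θ q.1 q.2)
    (hΘb : ∀ t, MapsTo (Θ t) sqBoundary sqBoundary) (f₀ f₁ : C((Fin N → I), Fin N → I))
    (h₀ : ∀ y, f₀ y = pairMap a b (Θ 0) y) (h₁ : ∀ y, f₁ y = pairMap a b (Θ 1) y) :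
    ContinuousMap.HomotopyWith f₀ f₁ BdPres where
  toFun q := pairMap a b (Θ q.1) q.2
  continuous_toFun := continuous_pairMap₂ hΘ
  map_zero_left y := (h₀ y).symm
  map_one_left y := (h₁ y).symm
  prop' t := fun _ hy => pairMap_mem_boundary hab (hΘb t) hy

/-- Stage 3 of the planar half-turn: the shear turned by `J`. [folklore] -/
def shear' (t : I) (p : I × I) : I × I := qt (shear t p)

/-- Stage 4 of the planar half-turn: scale back, turned by the half-turn. [folklore] -/
def scale' (t : I) (p : I × I) : I × I := ht (scale (σ t) p)

/-- `shear'` is jointly continuous. [folklore] -/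
lemma continuous_shear' : Continuous fun q : I × (I × I) => shear' q.1 q.2 :=
  continuous_qt.comp continuous_shear

/-- `scale'` is jointly continuous. [folklore] -/
lemma continuous_scale' : Continuous fun q : I × (I × I) => scale' q.1 q.2 :=
  continuous_ht.comp (continuous_scale.comp ((continuous_symm.comp continuous_fst).prodMk continuous_snd))

/-- `shear' t` is continuous (curried form). [folklore] -/
lemma continuous_shear'_right (t : I) : Continuous (shear' t) :=
  continuous_qt.comp (continuous_shear_right t)

/-- `scale' t` is continuous (curried form). [folklore] -/
lemma continuous_scale'_right (t : I) : Continuous (scale' t) :=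
  continuous_ht.comp (continuous_scale_right (σ t))

/-- `shear' t` preserves `∂I²`. [folklore] -/
lemma shear'_mem_sqBoundary (t : I) {p : I × I} (hp : p ∈ sqBoundary) : shear' t p ∈ sqBoundary :=
  qt_mem_sqBoundary (shear_mem_sqBoundary t hp)

/-- `scale' t` preserves `∂I²`. [folklore] -/
lemma scale'_mem_sqBoundary (t : I) {p : I × I} (hp : p ∈ sqBoundary) : scale' t p ∈ sqBoundary :=
  ht_mem_sqBoundary (scale_mem_sqBoundary _ hp)

/-- The seams: `shear' 0 = shear 1`. [folklore] -/
lemma shear'_zero (p : I × I) : shear' 0 p = shear 1 p := by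
  rw [shear', shear_zero, shear_one]

/-- The seams: `scale' 0 = shear' 1`. [folklore] -/
lemma scale'_zero (p : I × I) : scale' 0 p = shear' 1 p := by
  rw [scale', shear', symm_zero, shear_one, qt_qt]

/-- The end: `scale' 1 = ht`. [folklore] -/
lemma scale'_one (p : I × I) : scale' 1 p = ht p := by
  rw [scale', symm_one, scale_zero]

/-- **The half-turn `y ↦ (1 - y_a, 1 - y_b, y_rest)` of the cube in the `(a, b)`-plane.** [folklore] -/
def halfTurn (a b : Fin N) (y : Fin N → I) : Fin N → I := pairMap a b ht y

/-- The half-turn pointwise (`a ≠ b`). [folklore] -/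
lemma halfTurn_apply (hab : a ≠ b) (y : Fin N → I) (k : Fin N) :
    halfTurn a b y k = if k = a then σ (y a) else if k = b then σ (y b) else y k := by
  unfold halfTurn
  by_cases hka : k = a
  · subst hka; rw [if_pos rfl, pairMap_apply_fst hab]; rfl
  · rw [if_neg hka]
    by_cases hkb : k = b
    · subst hkb; rw [if_pos rfl, pairMap_apply_snd]; rfl
    · rw [if_neg hkb, pairMap_apply_of_ne hka hkb]

/-- The half-turn is continuous. [folklore] -/
lemma continuous_halfTurn (a b : Fin N) : Continuous (halfTurn a b) := continuous_pairMap continuous_ht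

/-- The half-turn is an involution (`a ≠ b`). [folklore] -/
lemma halfTurn_halfTurn (hab : a ≠ b) (y : Fin N → I) : halfTurn a b (halfTurn a b y) = y := by
  funext k
  rw [halfTurn_apply hab]
  by_cases hka : k = a
  · subst hka
    rw [if_pos rfl, halfTurn_apply hab, if_pos rfl, symm_symm]
  · rw [if_neg hka]
    by_cases hkb : k = b
    · subst hkb
      rw [if_pos rfl, halfTurn_apply hab, if_neg hab.symm, if_pos rfl, symm_symm]
    · rw [if_neg hkb, halfTurn_apply hab, if_neg hka, if_neg hkb]

/-- The half-turn preserves `∂Iᴺ` (`a ≠ b`). [folklore] -/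
lemma halfTurn_mem_boundary (hab : a ≠ b) {y : Fin N → I} (hy : y ∈ Cube.boundary (Fin N)) :
    halfTurn a b y ∈ Cube.boundary (Fin N) :=
  pairMap_mem_boundary hab (fun _ hp => ht_mem_sqBoundary hp) hy

/-- The five corner maps of the glued homotopy: `c₀ = id`-lift, …, `c₄ = ht`-lift. [folklore] -/
def c₀ (a b : Fin N) : C((Fin N → I), Fin N → I) := pm a b (scale 0) (continuous_scale_right 0)

/-- Corner map after stage 1. [folklore] -/
def c₁ (a b : Fin N) : C((Fin N → I), Fin N → I) := pm a b (shear 0) (continuous_shear_right 0)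

/-- Corner map after stage 2. [folklore] -/
def c₂ (a b : Fin N) : C((Fin N → I), Fin N → I) := pm a b (shear' 0) (continuous_shear'_right 0)

/-- Corner map after stage 3. [folklore] -/
def c₃ (a b : Fin N) : C((Fin N → I), Fin N → I) := pm a b (scale' 0) (continuous_scale'_right 0)

/-- Corner map after stage 4. [folklore] -/
def c₄ (a b : Fin N) : C((Fin N → I), Fin N → I) := pm a b (scale' 1) (continuous_scale'_right 1)

/-- **The four stages glued**: a homotopy of maps of pairs of the cube from the lift of
`scale 0 = id` to the lift of `scale' 1 = ht`. [folklore] -/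
def glued (hab : a ≠ b) : ContinuousMap.HomotopyWith (c₀ a b) (c₄ a b) BdPres :=
  ((stage hab scale continuous_scale scale_mem_sqBoundary (c₀ a b) (c₁ a b) (fun _ => rfl)
      (fun y => congrArg (fun θ : I × I → I × I => pairMap a b θ y) (funext fun p => shear_zero p))).trans
    (stage hab shear continuous_shear shear_mem_sqBoundary (c₁ a b) (c₂ a b) (fun _ => rfl)
      (fun y => congrArg (fun θ : I × I → I × I => pairMap a b θ y) (funext fun p => shear'_zero p)))).trans
  ((stage hab shear' continuous_shear' shear'_mem_sqBoundary (c₂ a b) (c₃ a b) (fun _ => rfl)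
      (fun y => congrArg (fun θ : I × I → I × I => pairMap a b θ y) (funext fun p => scale'_zero p))).trans
    (stage hab scale' continuous_scale' scale'_mem_sqBoundary (c₃ a b) (c₄ a b) (fun _ => rfl)
      (fun _ => rfl)))

/-- **The half-turn of the cube in a coordinate plane is homotopic to the identity through maps of
pairs `(Iᴺ, ∂Iᴺ) → (Iᴺ, ∂Iᴺ)`** (`a ≠ b`). [folklore] -/
theorem exists_homotopy (hab : a ≠ b) :
    ∃ H : C(I × (Fin N → I), Fin N → I), (∀ y, H (0, y) = y) ∧ (∀ y, H (1, y) = halfTurn a b y) ∧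
      ∀ (t : I), ∀ y ∈ Cube.boundary (Fin N), H (t, y) ∈ Cube.boundary (Fin N) := by
  refine ⟨(glued hab).toContinuousMap, fun y => ?_, fun y => ?_, fun t y hy => ?_⟩
  · have h : glued hab (0, y) = pairMap a b (scale 0) y := (glued hab).apply_zero y
    exact h.trans (CubeHAT.pairMap_eq_self_of (scale_zero _))
  · have h : glued hab (1, y) = pairMap a b (scale' 1) y := (glued hab).apply_one y
    exact h.trans (congrArg (fun θ : I × I → I × I => pairMap a b θ y) (funext fun p => scale'_one p))
  · exact (glued hab).prop' t hy

end HalfTurn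

end Literature.AlgebraicTopology.Homotopy

end
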